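import Mathlib
import Summits.KontsevichZagierPeriods.Zeta5Search.SingleRowLawProof
import Summits.KontsevichZagierPeriods.Zeta5Search.ClassExpBoundProof
import HarnessLib

/-!
# ζ(5) search — (CV) is a THEOREM wherever no residue class has two poles; on the record ray for `17n < p`, all `n`

Cell `pub-zeta5` (HONEST FRAMING: systematic search; no irrationality claim unless certified), typer seat
generation 9.  Gen-2 g5's OBSERVED Casoratian law (CV) (`CasoratianValuationLaw`:
`v_p(W(b+e_j)V(b) − W(b)V(b+e_j)) ≥ min(1,⌊d/p⌋) − N_p(b)`) holds at every window prime at which every residue class has at most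
one pole — then the `𝒦`-bracket is a sum of single-pole rows, each carrying the refund (`singleRowLaw_holds`, typer g9), and
gen-2 g8's road (`casoratian_split`, moments, THEOREM V) finishes:

* `casoratianLaw_of_noMultipole` — (CV) at `(b, j, p)` under `∀ x < p, classPoleCount b p x ≤ 1`;
* `classPoleCount_le_one_of_short_blocks` — this holds as soon as all blocks but one are shorter than `p`
  (`b₀ − 2b_k < p` for `k ≠ i`);
* **`recordRayCV_upper`** — on the Brown–Zudilin record ray `b = n·(41;17,…,11)`: (CV) for EVERY `n ≥ 1`, every `j`, and every
  prime `p > 17n` with `p² > 41n + 2` (the blocks have lengths `7n,…,17n,19n`).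
`p`-adic valuations of rational numbers; no NEAR-MISSES margin moves; nothing about irrationality.
-/

noncomputable section

open Finset

namespace Summit.KontsevichZagierPeriods.Zeta5Search.ClusterValuation

open Summit.KontsevichZagierPeriods.Zeta5Search.DualSeries (InBox)
open Summit.KontsevichZagierPeriods.Zeta5Search.WedgeDictionary (coeffV dOf)
open Summit.KontsevichZagierPeriods.Zeta5Search.CasoratianValuation (InPolytope pairFloors refund shift casoratian)
open Summit.KontsevichZagierPeriods.Zeta5Search.PadicSeries

variable {p : ℕ} [hp : Fact p.Prime]

/-! ### The `𝒦`-bracket without multipole classes -/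

/-- **(CV-𝒦) at a prime without multipole classes**: the bracket is a sum of single-pole rows. -/
theorem kBracket_bound_of_noMultipole (b : ℕ → ℤ) {j : ℕ} (hb : InPolytope b) (hj1 : 1 ≤ j) (hj7 : j ≤ 7)
    (hb' : InPolytope (shift b j)) (hp5 : 5 ≤ p) (hwin : (b 0 + 2 : ℤ) < (p : ℤ) ^ 2)
    (hno : ∀ x, x < p → classPoleCount b p x ≤ 1)
    (hne : kRes (shift b j) p * coeffV b - kRes b p * coeffV (shift b j) ≠ 0) :
    1 - pairFloors b p ≤ padicValRat p (kRes (shift b j) p * coeffV b - kRes b p * coeffV (shift b j)) := by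
  have hp0 : 0 < p := hp.out.pos
  have hsplit : kRes (shift b j) p * coeffV b - kRes b p * coeffV (shift b j) =
      ∑ x ∈ range p, (classK (shift b j) p x * coeffV b - classK b p x * coeffV (shift b j)) := by
    rw [kRes_eq_sum_classK (shift b j) hp0, kRes_eq_sum_classK b hp0, sum_mul, sum_mul, ← sum_sub_distrib]
  apply val_ge_of_padicNorm_le hne
  rw [hsplit]
  refine padicNorm.sum_le' (fun x hx => ?_) (zpow_p_nonneg _)
  have hx' := mem_range.1 hx
  rcases Nat.eq_zero_or_pos (classPoleCount b p x) with hc | hc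
  · have hc' : classPoleCount (shift b j) p x = 0 := by
      have := classPoleCount_shift_le b hb.1 hj1 p x; omega
    rw [classK_eq_zero_of_noPole b hb hc, classK_eq_zero_of_noPole (shift b j) hb' hc', zero_mul, zero_mul, sub_zero,
      padicNorm.zero]
    exact zpow_p_nonneg _
  · have hc1 : classPoleCount b p x = 1 := by have := hno x hx'; omega
    exact padicNorm_le_of_val fun h => singleRowLaw_holds b j p x hb hj1 hj7 hb' hp.out hp5 hwin hx' hc1 h

/-- **(CV) at a prime without multipole classes** (gen-2 g8's road, pointwise). -/
theorem casoratianLaw_of_noMultipole (b : ℕ → ℤ) {j : ℕ} (hb : InPolytope b) (hj1 : 1 ≤ j) (hj7 : j ≤ 7)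
    (hb' : InPolytope (shift b j)) (hp5 : 5 ≤ p) (hwin : (b 0 + 2 : ℤ) < (p : ℤ) ^ 2)
    (hno : ∀ x, x < p → classPoleCount b p x ≤ 1) (hcas : casoratian b j ≠ 0) :
    refund b p - pairFloors b p ≤ padicValRat p (casoratian b j) := by
  have hpp := hp.out
  have hp1 : (1 : ℚ) < p := by exact_mod_cast hpp.one_lt
  have hd0 : 0 ≤ dOf b := by
    have := hb.2.2; unfold dOf; linarith
  have hdshift : dOf (shift b j) = dOf b - 1 := BigPrime.dOf_shift b hj1 hj7
  have hN' : pairFloors (shift b j) p ≤ pairFloors b p := pairFloors_shift_le b hj1 p hpp.pos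
  have hwin' : (shift b j 0 + 2 : ℤ) < (p : ℤ) ^ 2 := by rwa [BigPrime.shift_zero b hj1]
  have hVb : padicNorm p (coeffV b) ≤ (p : ℚ) ^ pairFloors b p := padicNorm_coeffV_le_pairFloors b hb hp5 hwin
  have hVb' : padicNorm p (coeffV (shift b j)) ≤ (p : ℚ) ^ pairFloors b p :=
    (padicNorm_coeffV_le_pairFloors (shift b j) hb' hp5 hwin').trans (zpow_le_zpow_right₀ hp1.le hN')
  have hBb : padicNorm p (kRes (shift b j) p * coeffV b - kRes b p * coeffV (shift b j))
      ≤ (p : ℚ) ^ (-(1 - pairFloors b p)) :=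
    padicNorm_le_of_val (fun h => kBracket_bound_of_noMultipole b hb hj1 hj7 hb' hp5 hwin hno h)
  have hΩint : ∀ b' : ℕ → ℤ, InPolytope b' → padicNorm p (omegaRes b' p) ≤ 1 := fun b' hb'' =>
    padicNorm_omegaRes_le_one b' hb'' (by omega)
  apply val_ge_of_padicNorm_le hcas
  rw [casoratian_split b j p]
  by_cases hpd : (p : ℤ) ≤ dOf b
  · rw [omegaRes_eq_zero b hb (by omega), omegaRes_eq_zero (shift b j) hb' (by rw [hdshift]; omega), zero_mul, zero_mul,
      sub_zero, zero_sub, padicNorm.neg]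
    refine hBb.trans (zpow_le_zpow_right₀ hp1.le ?_)
    have : refund b p ≤ 1 := min_le_left _ _
    linarith
  · have hr : refund b p = 0 := by
      unfold refund
      rw [Int.ediv_eq_zero_of_lt hd0 (by omega)]; simp
    rw [hr, zero_sub, neg_neg]
    refine (padicNorm.sub (p := p)).trans (max_le ((padicNorm.sub (p := p)).trans (max_le ?_ ?_)) ?_)
    · rw [padicNorm.mul]
      calc padicNorm p (omegaRes (shift b j) p) * padicNorm p (coeffV b) ≤ 1 * (p : ℚ) ^ pairFloors b p :=
            mul_le_mul (hΩint _ hb') hVb (padicNorm.nonneg _) zero_le_one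
        _ = _ := one_mul _
    · rw [padicNorm.mul]
      calc padicNorm p (omegaRes b p) * padicNorm p (coeffV (shift b j)) ≤ 1 * (p : ℚ) ^ pairFloors b p :=
            mul_le_mul (hΩint _ hb) hVb' (padicNorm.nonneg _) zero_le_one
        _ = _ := one_mul _
    · exact hBb.trans (zpow_le_zpow_right₀ hp1.le (by linarith))

/-! ### When no class has two poles -/

omit hp in
/-- **If all blocks but one are shorter than `p`, no residue class has two poles** (two poles of one class lie in a common
block and differ by a non-zero multiple of `p`). -/
theorem classPoleCount_le_one_of_short_blocks (b : ℕ → ℤ) (hb : InPolytope b) (hp0 : 0 < p) {i : ℕ}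
    (hshort : ∀ k ∈ (range 7).erase i, b 0 - 2 * b (k + 1) < p) (x : ℕ) : classPoleCount b p x ≤ 1 := by
  by_contra hgt
  push Not at hgt
  have hbox : InBox b := hb.1
  obtain ⟨q₁, hq₁, q₂, hq₂, hne⟩ := one_lt_card.1 (by unfold classPoleCount at hgt; omega :
    1 < ((classSet b p x).filter fun s => netExp b s < 0).card)
  rw [mem_filter] at hq₁ hq₂
  -- each pole lies in a block other than `i`
  have hblk : ∀ q, netExp b q < 0 → ∃ k ∈ (range 7).erase i, q ∈ blk b k := by
    intro q hq
    have h2 := two_le_blockCount_of_pole b hq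
    rw [blockCount_eq] at h2
    have hne' : (((range 7).filter fun j => q ∈ blk b j).erase i).Nonempty := by
      rw [← card_pos]
      have := pred_card_le_card_erase (s := (range 7).filter fun j => q ∈ blk b j) (a := i)
      omega
    obtain ⟨k, hk⟩ := hne'
    obtain ⟨hki, hk'⟩ := mem_erase.1 hk
    obtain ⟨hk7, hqk⟩ := mem_filter.1 hk'
    exact ⟨k, mem_erase.2 ⟨hki, hk7⟩, hqk⟩
  obtain ⟨k₁, hk₁, hq₁k⟩ := hblk q₁ hq₁.2
  obtain ⟨k₂, hk₂, hq₂k⟩ := hblk q₂ hq₂.2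
  have hk₁7 := mem_range.1 (mem_erase.1 hk₁).2
  have hk₂7 := mem_range.1 (mem_erase.1 hk₂).2
  -- both poles lie in the larger of the two blocks
  obtain ⟨k, hk, hq₁', hq₂'⟩ : ∃ k ∈ (range 7).erase i, q₁ ∈ blk b k ∧ q₂ ∈ blk b k := by
    rcases le_total (b (k₁ + 1)) (b (k₂ + 1)) with h | h
    · exact ⟨k₁, hk₁, hq₁k, blk_subset_blk b hbox hk₁7 hk₂7 h hq₂k⟩
    · exact ⟨k₂, hk₂, blk_subset_blk b hbox hk₂7 hk₁7 h hq₁k, hq₂k⟩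
  have hk7 := mem_range.1 (mem_erase.1 hk).2
  -- their distance is a non-zero multiple of `p`, but the block is shorter than `p`
  have h1 := (mem_blk b k _).1 hq₁'
  have h2 := (mem_blk b k _).1 hq₂'
  have hβ : 0 ≤ b (k + 1) := (hbox.2 k (mem_range.2 hk7)).1
  have h0 : 0 ≤ b 0 := hbox.1
  have e0 : (((b 0).toNat : ℕ) : ℤ) = b 0 := Int.toNat_of_nonneg h0
  have e1 : (((b (k + 1)).toNat : ℕ) : ℤ) = b (k + 1) := Int.toNat_of_nonneg hβ
  have hlen := hshort k hk
  obtain ⟨m, hm⟩ := dvd_sub_of_mem_classSet b hq₁.1 hq₂.1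
  have hm0 : m ≠ 0 := by
    rintro rfl
    rw [mul_zero, sub_eq_zero] at hm
    exact hne (by exact_mod_cast hm)
  rcases lt_or_gt_of_ne hm0 with hneg | hpos
  · have : (p : ℤ) * m ≤ (p : ℤ) * (-1) := mul_le_mul_of_nonneg_left (by omega) (by omega)
    omega
  · have : (p : ℤ) * 1 ≤ (p : ℤ) * m := mul_le_mul_of_nonneg_left (by omega) (by omega)
    omega

/-! ### The record ray above `17n` -/

/-- **(CV) ON THE RECORD RAY FOR `p > 17n`, ALL `n`**: for `b = n·(41;17,…,11)`, every `n ≥ 1`, every direction `e_j` and every prime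
`p > 17n` with `p² > 41n + 2`. -/
theorem recordRayCV_upper (n j p : ℕ) (hn : 1 ≤ n) (hj1 : 1 ≤ j) (hj7 : j ≤ 7) (hprime : p.Prime) (hp5 : 5 ≤ p)
    (hpn : 17 * n < p) (hwin : (41 * n + 2 : ℤ) < (p : ℤ) ^ 2) (hcas : casoratian (bRec n) j ≠ 0) :
    refund (bRec n) p - pairFloors (bRec n) p ≤ padicValRat p (casoratian (bRec n) j) := by
  haveI : Fact p.Prime := ⟨hprime⟩
  have hwin' : (bRec n 0 + 2 : ℤ) < (p : ℤ) ^ 2 := by simpa [bRec, mul_comm] using hwin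
  refine casoratianLaw_of_noMultipole (bRec n) (inPolytope_bRec n) hj1 hj7 (inPolytope_shift_bRec n j hn hj1 hj7) hp5 hwin'
    (fun x _ => classPoleCount_le_one_of_short_blocks (bRec n) (inPolytope_bRec n) hprime.pos (i := 6) ?_ x) hcas
  intro k hk
  have hk7 := mem_range.1 (mem_erase.1 hk).2
  have hki := (mem_erase.1 hk).1
  interval_cases k <;> simp [bRec] <;> omega

end Summit.KontsevichZagierPeriods.Zeta5Search.ClusterValuation

end
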